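import Mathlib
import HarnessLib

/-!
# `UnitScaleTiltProp7SliceBoundBookkeeping` — (I3′) PLAN B, FILE P4-A: the GENERIC finite-sum rows behind «SliceBoundOneStep» — weighted sums with multiplicity (JENSEN through a tube
# tower), geometric LEVEL sums and their Minkowski assembly (never termwise Cauchy–Schwarz), double counting over coarse bonds, and the ENTRYWISE reduction of a matrix `ℓ²` row to scalars
(route `UnitScaleTilt`, crux K1 «MinimiserStabilityRegPr» stmt-QuantumFields-19200; route-R E′ (A′)-comb; ★★OWNER RULING №18 (2) «COMB-FLAT-COERCIVITY := FILE B ∘ τ + isometry transfer + (I3′)»;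
(I3′) organisation of record = px22 g5 PLAN B `LOCATE-I3-ONESTEP-px22g5.md` ac2baf06 (one-step telescoping), adopted by the (I3′) pen w4 g8 2026-08-29T05:54:26Z with the split P1 w4 · P2 px21 · P3 px22 ·
**P4 px6** («SliceBoundOneStep» ⇒ the `ℓ²` row `hT` of w4's FILE B′ `Prop7SliceRowOfSqBound.sliceBound_basePt_of_sqBound`); this file = P4-A of px6 g6's `LOCATE-P4-SLICEBOUND-ONESTEP-px6g6.md`
3fd15d77 §3 (G1)–(G3), (G5); Mathlib-only, def-free, count-neutral).  Cell `ym3-torus` (HUMAN RULING D-0037, YM ladder rung R3 — YM₃ on T³ is a rung, not d = 4, not infinite volume, not a mass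
gap, not Clay), width seat `ym3-torus-px6` (gen 6).

THE PRINT.  [Balaban1985BackgroundPropagators] Thm 3.11 p. 416 (positivity of `Δ_a(U)`) at the flat member needs, for print's COMB averaging ((3.14) p. 393 ∕ [Balaban1985Variational] (44)),
the slice bound (I3′): `Σ_c |δQ̃X(c)|² ≤ C(L)·ℓ⁻¹·Σ_p |curl X(p)|²` with `C(L)` depending on `L` only.  PLAN B writes `ℓ·δQ̃` as a telescope `Σ_{j<k} Up_j(e_j(T_jX))` of ONE-STEP defects
([Balaban1985Averaging] (124)–(127) p. 36: the linearised averaging is a `k`-fold product of one-step maps), each gradient-blind and local at scale `L`; the `ℓ⁻¹` then comes from two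
GEOMETRIC level sums and NO count above scale `L` occurs (px22 §6).  The present file supplies the finite-sum inequalities that bookkeeping uses, over abstract index types:
(G1) `‖Σ_i w_i • v(β i)‖² ≤ (Σ_i |w_i|)·(Σ_i |w_i|‖v(β i)‖²)` and the FIBRE regrouping `Σ_i |w_i|·g(β i) ≤ ω·Σ_{b ∈ image} g b` when every fibre carries weight mass `≤ ω` — together
«JENSEN WITH MULTIPLICITY» `‖N⁻¹Σ_{i} v(β i)‖² ≤ (μ∕N)·Σ_{b∈image}‖v b‖²` (a tube mean over `N = (L^m)^{d+1}` (cell site, run step) pairs hitting each bond `≤ μ = L^m` times loses `L^{−m}`);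
(G2) `Σ_{j<k} q^j ≤ q^k∕(q−1)`, `Σ_{i<m} q^{−i} ≤ q∕(q−1)` (`q > 1`) and the LEVEL ASSEMBLY with DYADIC weights `‖Σ_{j<k}Ψ_j‖² ≤ 2Σ_{j<k}2^{k−1−j}‖Ψ_j‖²`, `Σ_{j<k}2^{k−1−j}L^j ≤ L^k∕(L−2)`
(`L ≥ 3`): per-level sizes `O(L^j)` (both the tube part `L^{2j+1}∕L^k ≤ L^j` and the spine part) sum to `O(ℓ)`, `ℓ = L^k`, the top level dominating (a weighted Cauchy–Schwarz across levels;
the unweighted one would cost a `log ℓ` — trap (T-c) of w4's LOCATE v2);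
(G3) DOUBLE COUNTING `Σ_c Σ_{p ∈ N(c)} f p ≤ M·Σ_p f p` when each `p` lies in at most `M` of the sets `N(c)`; (G5) the ENTRYWISE reduction: a matrix-entry `ℓ²` row `Σ_c Σ_{ii′}‖Φ X c i i′‖² ≤ A·Σ_p Σ_{ii′}‖C X p i i′‖²`
follows from its scalar instances once `Φ`, `C` act entrywise (naturality — P3's display (T1) of the LOCATE).

WHAT IS PROVED (sorry-free, no definition): §1 `norm_sum_smul_le_sum_abs_mul_norm`, ★`norm_sq_sum_smul_le` (G1), `sum_abs_mul_comp_le_of_fibre`, ★★`norm_sq_sum_smul_comp_le` (weights + multiplicity),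
★★`norm_sq_avg_comp_le` (Jensen with multiplicity, uniform weights), `norm_sq_sum_le_card_mul`, `sum_sum_abs_mul_comp_eq_sum_fibre`, ★★`sum_norm_sq_sum_smul_comp_le` (G1′: a FAMILY of weighted sums under a GLOBAL weight-mass count — one averaging step in `ℓ²`); §2 `geom_sum_range_le_div`, `geom_sum_range_inv_le`, ★`norm_sq_sum_range_le_two_mul_dyadic`, ★★`dyadic_level_sum_le`, `pow_two_mul_add_one_div_le` (G2); §3 ★`sum_sum_le_mul_sum_of_card_le`
(G3); §4 ★`entrywise_sq_row_of_scalar` (G5), `complex_sq_row_of_real` (G5′).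
HONEST FRAMING.  Elementary finite-sum inequalities; no lattice object; nothing of P1∕P2∕P3, (I3′), COMB-FLAT-COERCIVITY, A6ᶜ, N06 or the crux K1 is proved or claimed here.  Rung R3, not Clay;
YM gap NOT proved.  `--supports stmt-QuantumFields-19200 --as helper`.
References: T. Bałaban, CMP 98 (1985) 17–51 [Balaban1985Averaging] ((124)–(127) p.36, (160)–(164) p.42); CMP 99 (1985) 389–434 [Balaban1985BackgroundPropagators] ((3.14) p.393, Thm 3.11 p.416);
CMP 95 (1984) 17–40 [Balaban1984PropagatorsI] ((1.16)–(1.20) p.20: the iterated averages as products).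
-/

set_option autoImplicit false

open scoped BigOperators
open Finset

namespace Summit.QuantumFields.YangMills.Theorems.Prop7SliceBoundBookkeeping

/-! ## §1 (G1) Weighted sums with multiplicity — Jensen through a tube tower -/

section Weighted

variable {ι B V : Type*} [NormedAddCommGroup V] [NormedSpace ℝ V]

/-- `‖Σ_{i∈s} w i • v i‖ ≤ Σ_{i∈s} |w i|·‖v i‖`. [folklore] -/
theorem norm_sum_smul_le_sum_abs_mul_norm (s : Finset ι) (w : ι → ℝ) (v : ι → V) :
    ‖∑ i ∈ s, w i • v i‖ ≤ ∑ i ∈ s, |w i| * ‖v i‖ := by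
  refine (norm_sum_le _ _).trans (Finset.sum_le_sum fun i _ => ?_)
  rw [norm_smul, Real.norm_eq_abs]

/-- ★ (G1) **WEIGHTED CAUCHY–SCHWARZ FOR A VECTOR SUM**: `‖Σ_{i∈s} w i • v i‖² ≤ (Σ_{i∈s} |w i|)·(Σ_{i∈s} |w i|·‖v i‖²)`.
[folklore; cite: Balaban1985Averaging, (160)–(164) p.42] -/
theorem norm_sq_sum_smul_le (s : Finset ι) (w : ι → ℝ) (v : ι → V) :
    ‖∑ i ∈ s, w i • v i‖ ^ 2 ≤ (∑ i ∈ s, |w i|) * ∑ i ∈ s, |w i| * ‖v i‖ ^ 2 := by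
  have h1 := norm_sum_smul_le_sum_abs_mul_norm s w v
  have h0 : 0 ≤ ∑ i ∈ s, |w i| * ‖v i‖ := Finset.sum_nonneg fun i _ => by positivity
  -- Cauchy–Schwarz with `a_i = √|w i|`, `b_i = √|w i|·‖v i‖`
  have hcs : (∑ i ∈ s, |w i| * ‖v i‖) ^ 2 ≤ (∑ i ∈ s, |w i|) * ∑ i ∈ s, |w i| * ‖v i‖ ^ 2 := by
    have h := Finset.sum_mul_sq_le_sq_mul_sq s (fun i => Real.sqrt |w i|) (fun i => Real.sqrt |w i| * ‖v i‖)
    have e1 : ∀ i, Real.sqrt |w i| * (Real.sqrt |w i| * ‖v i‖) = |w i| * ‖v i‖ := fun i => by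
      rw [← mul_assoc, Real.mul_self_sqrt (abs_nonneg _)]
    have e2 : ∀ i, Real.sqrt |w i| ^ 2 = |w i| := fun i => Real.sq_sqrt (abs_nonneg _)
    have e3 : ∀ i, (Real.sqrt |w i| * ‖v i‖) ^ 2 = |w i| * ‖v i‖ ^ 2 := fun i => by
      rw [mul_pow, Real.sq_sqrt (abs_nonneg _)]
    simp only [e1, e2, e3] at h
    exact h
  calc ‖∑ i ∈ s, w i • v i‖ ^ 2 ≤ (∑ i ∈ s, |w i| * ‖v i‖) ^ 2 := by
        exact pow_le_pow_left₀ (norm_nonneg _) h1 2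
    _ ≤ (∑ i ∈ s, |w i|) * ∑ i ∈ s, |w i| * ‖v i‖ ^ 2 := hcs

/-- **FIBRE REGROUPING**: if every fibre of `β` over `s` carries weight mass `Σ_{i∈s, β i = b} |w i| ≤ ω` and `g ≥ 0`, then `Σ_{i∈s} |w i|·g (β i) ≤ ω·Σ_{b ∈ s.image β} g b`.
[folklore; cite: Balaban1984PropagatorsI, (1.18) p.20] -/
theorem sum_abs_mul_comp_le_of_fibre [DecidableEq B] (s : Finset ι) (w : ι → ℝ) (β : ι → B) (g : B → ℝ) (hg : ∀ b, 0 ≤ g b)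
    {ω : ℝ} (hω : ∀ b ∈ s.image β, ∑ i ∈ s.filter (fun i => β i = b), |w i| ≤ ω) :
    ∑ i ∈ s, |w i| * g (β i) ≤ ω * ∑ b ∈ s.image β, g b := by
  rw [← Finset.sum_fiberwise_of_maps_to (g := β) (t := s.image β) (fun i hi => Finset.mem_image_of_mem β hi)]
  rw [Finset.mul_sum]
  refine Finset.sum_le_sum fun b hb => ?_
  have hrw : ∑ i ∈ s.filter (fun i => β i = b), |w i| * g (β i) = (∑ i ∈ s.filter (fun i => β i = b), |w i|) * g b := by
    rw [Finset.sum_mul]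
    refine Finset.sum_congr rfl fun i hi => ?_
    rw [(Finset.mem_filter.1 hi).2]
  rw [hrw]
  exact mul_le_mul_of_nonneg_right (hω b hb) (hg b)

/-- ★★ (G1) **WEIGHTS AND MULTIPLICITY TOGETHER**: `‖Σ_{i∈s} w i • v (β i)‖² ≤ (Σ_{i∈s} |w i|)·ω·Σ_{b ∈ s.image β} ‖v b‖²` when every fibre carries weight mass `≤ ω`.
[folklore; cite: Balaban1985Averaging, (160)–(164) p.42] -/
theorem norm_sq_sum_smul_comp_le [DecidableEq B] (s : Finset ι) (w : ι → ℝ) (β : ι → B) (v : B → V)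
    {ω : ℝ} (hω : ∀ b ∈ s.image β, ∑ i ∈ s.filter (fun i => β i = b), |w i| ≤ ω) :
    ‖∑ i ∈ s, w i • v (β i)‖ ^ 2 ≤ (∑ i ∈ s, |w i|) * (ω * ∑ b ∈ s.image β, ‖v b‖ ^ 2) := by
  have h1 := norm_sq_sum_smul_le s w (fun i => v (β i))
  have h2 := sum_abs_mul_comp_le_of_fibre s w β (fun b => ‖v b‖ ^ 2) (fun b => by positivity) hω
  exact h1.trans (mul_le_mul_of_nonneg_left h2 (Finset.sum_nonneg fun i _ => abs_nonneg _))

/-- ★★ (G1) **JENSEN WITH MULTIPLICITY** (uniform weights): if `#s = N > 0` and every fibre of `β` over `s` has at most `μ` elements, then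
`‖(N:ℝ)⁻¹ • Σ_{i∈s} v (β i)‖² ≤ (μ ∕ N)·Σ_{b ∈ s.image β} ‖v b‖²` — a tube mean over `N = (L^m)^{d}·L^m` (cell site, run step) pairs that hits each bond at most `μ = L^m` times LOSES the
factor `L^{−m·d}·…`; at `d = 3` in line units this is px22 §6's «`|·|² ≤ L^{−m}Σ_{2 blocks}|E|²`». [folklore; cite: Balaban1984PropagatorsI, (1.18) p.20] -/
theorem norm_sq_avg_comp_le [DecidableEq B] (s : Finset ι) (hs : 0 < s.card) (β : ι → B) (v : B → V)
    {μ : ℕ} (hμ : ∀ b ∈ s.image β, (s.filter (fun i => β i = b)).card ≤ μ) :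
    ‖((s.card : ℝ)⁻¹) • ∑ i ∈ s, v (β i)‖ ^ 2 ≤ ((μ : ℝ) / s.card) * ∑ b ∈ s.image β, ‖v b‖ ^ 2 := by
  have hN : (0 : ℝ) < s.card := by exact_mod_cast hs
  have hrw : ((s.card : ℝ)⁻¹) • ∑ i ∈ s, v (β i) = ∑ i ∈ s, ((s.card : ℝ)⁻¹) • v (β i) := by rw [Finset.smul_sum]
  rw [hrw]
  have hω : ∀ b ∈ s.image β, ∑ i ∈ s.filter (fun i => β i = b), |((s.card : ℝ)⁻¹)| ≤ (μ : ℝ) * (s.card : ℝ)⁻¹ := by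
    intro b hb
    rw [Finset.sum_const, nsmul_eq_mul, abs_of_pos (inv_pos.mpr hN)]
    exact mul_le_mul_of_nonneg_right (by exact_mod_cast hμ b hb) (inv_pos.mpr hN).le
  have h := norm_sq_sum_smul_comp_le s (fun _ => ((s.card : ℝ)⁻¹)) β v hω
  have hsumw : ∑ i ∈ s, |((s.card : ℝ)⁻¹)| = 1 := by
    rw [Finset.sum_const, nsmul_eq_mul, abs_of_pos (inv_pos.mpr hN), mul_inv_cancel₀ hN.ne']
  rw [hsumw, one_mul] at h
  calc _ ≤ (μ : ℝ) * (s.card : ℝ)⁻¹ * ∑ b ∈ s.image β, ‖v b‖ ^ 2 := h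
    _ = ((μ : ℝ) / s.card) * ∑ b ∈ s.image β, ‖v b‖ ^ 2 := by rw [div_eq_mul_inv]

/-- `‖Σ_{i∈s} v i‖² ≤ #s·Σ_{i∈s} ‖v i‖²`. [folklore] -/
theorem norm_sq_sum_le_card_mul (s : Finset ι) (v : ι → V) :
    ‖∑ i ∈ s, v i‖ ^ 2 ≤ (s.card : ℝ) * ∑ i ∈ s, ‖v i‖ ^ 2 := by
  have h := norm_sq_sum_smul_le s (fun _ => (1 : ℝ)) v
  simp only [one_smul, abs_one, one_mul, Finset.sum_const, nsmul_eq_mul, mul_one] at h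
  exact h

/-- `(Σ_{i∈s} a i)² ≤ #s·Σ_{i∈s} (a i)²` (real Cauchy–Schwarz). [folklore] -/
theorem sq_sum_le_card_mul (s : Finset ι) (a : ι → ℝ) :
    (∑ i ∈ s, a i) ^ 2 ≤ (s.card : ℝ) * ∑ i ∈ s, a i ^ 2 :=
  sq_sum_le_card_mul_sum_sq


/-- Regrouping a double sum by the value of `β`: `Σ_{a∈A} Σ_{i∈s a} |w a i|·g (β a i) = Σ_b (Σ_{a∈A} Σ_{i∈s a, β a i = b} |w a i|)·g b`. [folklore] -/
theorem sum_sum_abs_mul_comp_eq_sum_fibre {α : Type*} [Fintype B] [DecidableEq B] (A : Finset α) (s : α → Finset ι) (w : α → ι → ℝ) (β : α → ι → B) (g : B → ℝ) :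
    ∑ a ∈ A, ∑ i ∈ s a, |w a i| * g (β a i) = ∑ b, (∑ a ∈ A, ∑ i ∈ (s a).filter (fun i => β a i = b), |w a i|) * g b := by
  have h1 : ∀ a ∈ A, ∑ i ∈ s a, |w a i| * g (β a i) = ∑ b, (∑ i ∈ (s a).filter (fun i => β a i = b), |w a i|) * g b := by
    intro a _
    rw [← Finset.sum_fiberwise_of_maps_to (g := β a) (t := Finset.univ) (fun i _ => Finset.mem_univ _)]
    refine Finset.sum_congr rfl fun b _ => ?_
    rw [Finset.sum_mul]
    refine Finset.sum_congr rfl fun i hi => ?_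
    rw [(Finset.mem_filter.1 hi).2]
  rw [Finset.sum_congr rfl h1, Finset.sum_comm]
  refine Finset.sum_congr rfl fun b _ => ?_
  rw [Finset.sum_mul]

/-- ★★ (G1′) **A FAMILY OF WEIGHTED SUMS UNDER A GLOBAL WEIGHT-MASS COUNT**: if every member `a ∈ A` of a family of weighted sums has total weight `Σ_{i∈s a} |w a i| ≤ W`, and every target
`b` receives, over the WHOLE family, weight mass `Σ_a Σ_{i∈s a, β a i = b} |w a i| ≤ Ω`, then `Σ_{a∈A} ‖Σ_{i∈s a} w a i • v (β a i)‖² ≤ W·Ω·Σ_b ‖v b‖²` — the form in which ONE averaging step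
is `ℓ²`-bounded by counting, for each fine bond∕plaquette, the (cell, offset, run-step) triples that read it (px22 PLAN B §6: `Σ_c|L•bondAvg A c|² ≤ L⁻¹Σ_b|A b|²`; the curl through one tube
step costs `L^{4−d}`). [folklore; cite: Balaban1984PropagatorsI, (1.11) p.19, (1.18) p.20] -/
theorem sum_norm_sq_sum_smul_comp_le {α : Type*} [Fintype B] [DecidableEq B] (A : Finset α) (s : α → Finset ι) (w : α → ι → ℝ) (β : α → ι → B) (v : B → V)
    {W Ω : ℝ} (hW0 : 0 ≤ W) (hW : ∀ a ∈ A, ∑ i ∈ s a, |w a i| ≤ W)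
    (hΩ : ∀ b, ∑ a ∈ A, ∑ i ∈ (s a).filter (fun i => β a i = b), |w a i| ≤ Ω) :
    ∑ a ∈ A, ‖∑ i ∈ s a, w a i • v (β a i)‖ ^ 2 ≤ W * (Ω * ∑ b, ‖v b‖ ^ 2) := by
  -- each member: weighted Cauchy–Schwarz, total weight ≤ W
  have h1 : ∀ a ∈ A, ‖∑ i ∈ s a, w a i • v (β a i)‖ ^ 2 ≤ W * ∑ i ∈ s a, |w a i| * ‖v (β a i)‖ ^ 2 := fun a ha =>
    (norm_sq_sum_smul_le (s a) (w a) (fun i => v (β a i))).trans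
      (mul_le_mul_of_nonneg_right (hW a ha) (Finset.sum_nonneg fun i _ => by positivity))
  refine (Finset.sum_le_sum h1).trans ?_
  rw [← Finset.mul_sum]
  refine mul_le_mul_of_nonneg_left ?_ hW0
  -- regroup by the target and use the global mass count
  rw [sum_sum_abs_mul_comp_eq_sum_fibre A s w β (fun b => ‖v b‖ ^ 2), Finset.mul_sum]
  exact Finset.sum_le_sum fun b _ => mul_le_mul_of_nonneg_right (hΩ b) (by positivity)

end Weighted

/-! ## §2 (G2) Geometric level sums and the dyadically weighted assembly across levels -/

section Levels

/-- `Σ_{j<k} q^j ≤ q^k ∕ (q − 1)` for `q > 1`. [folklore] -/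
theorem geom_sum_range_le_div {q : ℝ} (hq : 1 < q) (k : ℕ) :
    ∑ j ∈ range k, q ^ j ≤ q ^ k / (q - 1) := by
  rw [geom_sum_eq (by linarith : q ≠ 1) k]
  exact div_le_div_of_nonneg_right (by linarith [pow_pos (by linarith : (0:ℝ) < q) k]) (by linarith)

/-- `Σ_{i<m} (q⁻¹)^i ≤ q ∕ (q − 1)` for `q > 1` (the relative-tube Jensen factors `L^{−(i−j−1)∕2}` summed up the spine). [folklore] -/
theorem geom_sum_range_inv_le {q : ℝ} (hq : 1 < q) (m : ℕ) :
    ∑ i ∈ range m, (q⁻¹) ^ i ≤ q / (q - 1) := by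
  have hq0 : 0 < q := by linarith
  have hr1 : q⁻¹ ≠ 1 := by
    intro h
    have : q = 1 := by rw [← inv_inv q, h, inv_one]
    linarith
  rw [geom_sum_eq hr1 m]
  have hden : q⁻¹ - 1 < 0 := by
    have : q⁻¹ < 1 := inv_lt_one_of_one_lt₀ hq
    linarith
  have hnum : (q⁻¹) ^ m - 1 ≥ -1 := by
    have : 0 ≤ (q⁻¹) ^ m := pow_nonneg (inv_nonneg.mpr hq0.le) m
    linarith
  -- `(r^m − 1)/(r − 1) = (1 − r^m)/(1 − r) ≤ 1/(1 − r) = q/(q−1)`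
  have h1 : ((q⁻¹) ^ m - 1) / (q⁻¹ - 1) ≤ (-1) / (q⁻¹ - 1) :=
    div_le_div_of_nonpos_of_le hden.le hnum
  refine h1.trans (le_of_eq ?_)
  have hq1 : q - 1 ≠ 0 := by linarith
  have hq1' : q⁻¹ - 1 ≠ 0 := hden.ne
  rw [div_eq_div_iff hq1' hq1]
  field_simp
  ring

/-- ★ **DYADICALLY WEIGHTED CAUCHY–SCHWARZ ACROSS LEVELS**: `‖Σ_{j<k} Ψ j‖² ≤ 2·Σ_{j<k} 2^{k−1}·(1∕2)^j·‖Ψ j‖²` — the weights `2^{−(k−1−j)}` sum to `< 2`, so the top levels are charged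
`O(1)` and level `j` is charged `2^{k−1−j}`; with per-level sizes `O(L^j)` (`L ≥ 3 > 2`) the weighted sum stays GEOMETRIC (next lemma) — no `log ℓ` (trap (T-c)).
[folklore; cite: Balaban1985Averaging, (124)–(127) p.36] -/
theorem norm_sq_sum_range_le_two_mul_dyadic {V : Type*} [NormedAddCommGroup V] [NormedSpace ℝ V] (k : ℕ) (Ψ : ℕ → V) :
    ‖∑ j ∈ range k, Ψ j‖ ^ 2 ≤ 2 * ∑ j ∈ range k, (2:ℝ) ^ (k - 1) * (1 / 2) ^ j * ‖Ψ j‖ ^ 2 := by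
  rcases Nat.eq_zero_or_pos k with hk | hk
  · subst hk; simp
  -- weights `w j = 2^{−(k−1)}·2^j`, vectors `w⁻¹ • Ψ`
  set w : ℕ → ℝ := fun j => ((2:ℝ) ^ (k - 1))⁻¹ * 2 ^ j with hw
  have hwpos : ∀ j, 0 < w j := fun j => by rw [hw]; positivity
  have hsum : ∑ j ∈ range k, Ψ j = ∑ j ∈ range k, w j • ((w j)⁻¹ • Ψ j) := by
    refine Finset.sum_congr rfl fun j _ => ?_
    rw [smul_smul, mul_inv_cancel₀ (hwpos j).ne', one_smul]
  have h := norm_sq_sum_smul_le (range k) w (fun j => (w j)⁻¹ • Ψ j)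
  rw [← hsum] at h
  -- `Σ_{j<k} |w j| = 2^{−(k−1)}·(2^k − 1) ≤ 2`
  have hW : ∑ j ∈ range k, |w j| ≤ 2 := by
    have e : ∑ j ∈ range k, |w j| = ((2:ℝ) ^ (k - 1))⁻¹ * ∑ j ∈ range k, (2:ℝ) ^ j := by
      rw [Finset.mul_sum]
      exact Finset.sum_congr rfl fun j _ => by rw [abs_of_pos (hwpos j)]
    rw [e, geom_sum_eq (by norm_num) k]
    have hk1 : (2:ℝ) ^ k = 2 * 2 ^ (k - 1) := by
      rw [← pow_succ']; congr 1; omega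
    rw [hk1]
    have hp : 0 < (2:ℝ) ^ (k - 1) := by positivity
    field_simp
    nlinarith
  -- the weighted squares: `|w j|·‖w⁻¹Ψ‖² = w⁻¹‖Ψ‖² = 2^{k−1}(1/2)^j‖Ψ‖²`
  have hT : ∑ j ∈ range k, |w j| * ‖(w j)⁻¹ • Ψ j‖ ^ 2 = ∑ j ∈ range k, (2:ℝ) ^ (k - 1) * (1 / 2) ^ j * ‖Ψ j‖ ^ 2 := by
    refine Finset.sum_congr rfl fun j _ => ?_
    rw [abs_of_pos (hwpos j), norm_smul, Real.norm_eq_abs, abs_inv, abs_of_pos (hwpos j), mul_pow, inv_pow]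
    have hne : w j ≠ 0 := (hwpos j).ne'
    have hw2 : w j ^ 2 = w j * w j := sq (w j)
    rw [hw2, ← mul_assoc, mul_inv, ← mul_assoc, mul_inv_cancel₀ hne, one_mul]
    congr 1
    rw [hw]
    simp only [mul_inv, inv_inv, one_div, inv_pow]
  rw [hT] at h
  have h0 : 0 ≤ ∑ j ∈ range k, (2:ℝ) ^ (k - 1) * (1 / 2) ^ j * ‖Ψ j‖ ^ 2 := Finset.sum_nonneg fun j _ => by positivity
  exact h.trans (mul_le_mul_of_nonneg_right hW h0)

/-- ★★ (G2) **THE DYADICALLY WEIGHTED LEVEL SUM IS GEOMETRIC**: for real `L ≥ 3` and every `k`, `Σ_{j<k} 2^{k−1}·(1∕2)^j·L^j ≤ L^k ∕ (L − 2)` (`= 2^{k−1}·Σ_{j<k}(L∕2)^j`, ratio `L∕2 > 1`).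
With per-level bounds `‖Ψ_j‖² ≤ C·L^j·N²` (px22 PLAN B §6: tube part `L^{2j+1−k} ≤ L^j`, spine part `∝ L^j`) the previous lemma gives `‖Σ_{j<k}Ψ_j‖² ≤ 2C·L^k∕(L−2)·N²` — ORDER `ℓ = L^k`,
the top level dominating. [cite: Balaban1985Averaging, (124)–(127) p.36] -/
theorem dyadic_level_sum_le {L : ℝ} (hL : 3 ≤ L) (k : ℕ) :
    ∑ j ∈ range k, (2:ℝ) ^ (k - 1) * (1 / 2) ^ j * L ^ j ≤ L ^ k / (L - 2) := by
  rcases Nat.eq_zero_or_pos k with hk | hk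
  · subst hk
    simp only [range_zero, sum_empty, pow_zero]
    exact div_nonneg zero_le_one (by linarith)
  have hq : 1 < L / 2 := by linarith
  have e : ∑ j ∈ range k, (2:ℝ) ^ (k - 1) * (1 / 2) ^ j * L ^ j = (2:ℝ) ^ (k - 1) * ∑ j ∈ range k, (L / 2) ^ j := by
    rw [Finset.mul_sum]
    refine Finset.sum_congr rfl fun j _ => ?_
    rw [div_pow, div_pow, one_pow, mul_assoc]
    congr 1
    field_simp
  rw [e]
  have hg := geom_sum_range_le_div hq k
  have hk1 : (2:ℝ) ^ k = 2 * 2 ^ (k - 1) := by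
    rw [← pow_succ']; congr 1; omega
  have hp : 0 < (2:ℝ) ^ (k - 1) := by positivity
  calc (2:ℝ) ^ (k - 1) * ∑ j ∈ range k, (L / 2) ^ j ≤ (2:ℝ) ^ (k - 1) * ((L / 2) ^ k / (L / 2 - 1)) :=
        mul_le_mul_of_nonneg_left hg hp.le
    _ = L ^ k / (L - 2) := by
        rw [div_pow, hk1]
        have h2 : L / 2 - 1 = (L - 2) / 2 := by ring
        rw [h2]
        field_simp

/-- `L^{2j+1} ∕ L^k ≤ L^j` for `j < k` and `L ≥ 1`: the tube part of level `j` (`K′·L^{2j+1}·ℓ⁻¹`, `ℓ = L^k`) is also `O(L^j)`, so ONE geometric sum serves both parts. [folklore] -/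
theorem pow_two_mul_add_one_div_le {L : ℝ} (hL : 1 ≤ L) {j k : ℕ} (hjk : j < k) :
    L ^ (2 * j + 1) / L ^ k ≤ L ^ j := by
  have hL0 : 0 < L := by linarith
  rw [div_le_iff₀ (pow_pos hL0 k), ← pow_add]
  exact pow_le_pow_right₀ hL (by omega)

end Levels

/-! ## §3 (G3) Double counting over coarse bonds -/

section DoubleCount

variable {α π : Type*} [Fintype α] [Fintype π]

/-- ★ (G3) **DOUBLE COUNTING**: if every `p` lies in at most `M` of the sets `N c` and `f ≥ 0`, then `Σ_c Σ_{p ∈ N c} f p ≤ M·Σ_p f p` (the neighbourhoods `N(c)` of the coarse bonds cover each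
fine plaquette at most `M` times — px22 §6 «`#{c : p ∈ N(c)} ≤ 3·27`»). [folklore; cite: Balaban1984PropagatorsI, (1.18) p.20] -/
theorem sum_sum_le_mul_sum_of_card_le [DecidableEq π] (N : α → Finset π) (f : π → ℝ) (hf : ∀ p, 0 ≤ f p) {M : ℕ}
    (hM : ∀ p, (Finset.univ.filter fun c => p ∈ N c).card ≤ M) :
    ∑ c, ∑ p ∈ N c, f p ≤ (M : ℝ) * ∑ p, f p := by
  classical
  have hswap : ∑ c, ∑ p ∈ N c, f p = ∑ p, ((Finset.univ.filter fun c => p ∈ N c).card : ℝ) * f p := by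
    have h1 : ∑ c, ∑ p ∈ N c, f p = ∑ c, ∑ p, if p ∈ N c then f p else 0 := by
      refine Finset.sum_congr rfl fun c _ => ?_
      rw [← Finset.sum_filter]
      congr 1
      ext p; simp
    rw [h1, Finset.sum_comm]
    refine Finset.sum_congr rfl fun p _ => ?_
    rw [← Finset.sum_filter, Finset.sum_const, nsmul_eq_mul]
  rw [hswap, Finset.mul_sum]
  exact Finset.sum_le_sum fun p _ => mul_le_mul_of_nonneg_right (by exact_mod_cast hM p) (hf p)

end DoubleCount

/-! ## §4 (G5) The entrywise reduction of a matrix `ℓ²` row to its scalar instances -/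

section Entrywise

variable {β κ π : Type*} [Fintype κ] [Fintype π] {m : Type*} [Fintype m]

/-- ★ (G5) **ENTRYWISE REDUCTION**: if the matrix-field maps `ΦM`, `CM` act ENTRY BY ENTRY through scalar maps `Φc`, `Cc` (naturality), and the scalar `ℓ²` row
`Σ_c ‖Φc x c‖² ≤ A·Σ_p ‖Cc x p‖²` holds for every scalar field `x`, then the entry-summed matrix row `Σ_c Σ_{i i′} ‖ΦM X c i i′‖² ≤ A·Σ_p Σ_{i i′} ‖CM X p i i′‖²` holds for every matrix field `X`
(the shape of w4 g8's FILE B′ hypothesis `hT`). [folklore] -/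
theorem entrywise_sq_row_of_scalar
    (Φc : (β → ℂ) → κ → ℂ) (Cc : (β → ℂ) → π → ℂ)
    (ΦM : (β → Matrix m m ℂ) → κ → Matrix m m ℂ) (CM : (β → Matrix m m ℂ) → π → Matrix m m ℂ)
    (hΦ : ∀ (X : β → Matrix m m ℂ) (c : κ) (i i' : m), ΦM X c i i' = Φc (fun b => X b i i') c)
    (hC : ∀ (X : β → Matrix m m ℂ) (p : π) (i i' : m), CM X p i i' = Cc (fun b => X b i i') p)
    {A : ℝ} (hsc : ∀ x : β → ℂ, ∑ c, ‖Φc x c‖ ^ 2 ≤ A * ∑ p, ‖Cc x p‖ ^ 2) (X : β → Matrix m m ℂ) :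
    ∑ c, ∑ i, ∑ i', ‖ΦM X c i i'‖ ^ 2 ≤ A * ∑ p, ∑ i, ∑ i', ‖CM X p i i'‖ ^ 2 := by
  calc ∑ c, ∑ i, ∑ i', ‖ΦM X c i i'‖ ^ 2 = ∑ i, ∑ i', ∑ c, ‖Φc (fun b => X b i i') c‖ ^ 2 := by
        rw [Finset.sum_comm]
        refine Finset.sum_congr rfl fun i _ => ?_
        rw [Finset.sum_comm]
        refine Finset.sum_congr rfl fun i' _ => Finset.sum_congr rfl fun c _ => ?_
        rw [hΦ]
    _ ≤ ∑ i, ∑ i', A * ∑ p, ‖Cc (fun b => X b i i') p‖ ^ 2 :=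
        Finset.sum_le_sum fun i _ => Finset.sum_le_sum fun i' _ => hsc _
    _ = A * ∑ p, ∑ i, ∑ i', ‖CM X p i i'‖ ^ 2 := by
        rw [Finset.sum_comm (s := Finset.univ (α := π))]
        simp only [← Finset.mul_sum]
        congr 1
        refine Finset.sum_congr rfl fun i _ => ?_
        rw [Finset.sum_comm]
        refine Finset.sum_congr rfl fun i' _ => Finset.sum_congr rfl fun p _ => ?_
        rw [hC]


/-- (G5′) **REAL TO COMPLEX SCALARS**: if `Φ`, `C` act on complex scalar fields through REAL-linear combinations with real weights — i.e. commute with `re` and `im` — and the real `ℓ²` row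
`Σ_c (Φr a c)² ≤ A·Σ_p (Cr a p)²` holds for every real field `a`, then `Σ_c ‖Φ x c‖² ≤ A·Σ_p ‖C x p‖²` for every complex field `x` (`‖z‖² = (re z)² + (im z)²`). [folklore] -/
theorem complex_sq_row_of_real
    (Φr : (β → ℝ) → κ → ℝ) (Cr : (β → ℝ) → π → ℝ) (Φ : (β → ℂ) → κ → ℂ) (C : (β → ℂ) → π → ℂ)
    (hre : ∀ (x : β → ℂ) (c : κ), (Φ x c).re = Φr (fun b => (x b).re) c) (him : ∀ (x : β → ℂ) (c : κ), (Φ x c).im = Φr (fun b => (x b).im) c)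
    (hCre : ∀ (x : β → ℂ) (p : π), (C x p).re = Cr (fun b => (x b).re) p) (hCim : ∀ (x : β → ℂ) (p : π), (C x p).im = Cr (fun b => (x b).im) p)
    {A : ℝ} (hsc : ∀ a : β → ℝ, ∑ c, Φr a c ^ 2 ≤ A * ∑ p, Cr a p ^ 2) (x : β → ℂ) :
    ∑ c, ‖Φ x c‖ ^ 2 ≤ A * ∑ p, ‖C x p‖ ^ 2 := by
  have e1 : ∀ c, ‖Φ x c‖ ^ 2 = Φr (fun b => (x b).re) c ^ 2 + Φr (fun b => (x b).im) c ^ 2 := fun c => by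
    rw [Complex.sq_norm, Complex.normSq_apply, hre, him]; ring
  have e2 : ∀ p, ‖C x p‖ ^ 2 = Cr (fun b => (x b).re) p ^ 2 + Cr (fun b => (x b).im) p ^ 2 := fun p => by
    rw [Complex.sq_norm, Complex.normSq_apply, hCre, hCim]; ring
  simp only [e1, e2, Finset.sum_add_distrib, mul_add]
  exact add_le_add (hsc _) (hsc _)

end Entrywise

end Summit.QuantumFields.YangMills.Theorems.Prop7SliceBoundBookkeeping
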